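import Summits.BirchSwinnertonDyer.Rank1Residual.Additive.RamifiedSevenGenusSinnottSpan
import Literature.NumberTheory.GaloisRepresentations.CyclotomicCharacterSurjectiveProofs
import HarnessLib

set_option autoImplicit false

/-!
# `𝒞₇` genus road (crux `EllipticUnitValueSevenOfGZK`, K7r), the (5)-unit programme (SUMMON GENUS-UNIT-A6), File E1:
# GALOIS LIFTS FOR THE GENUS TOWER — every `σ_a ∈ Gal(F′ₙ/ℚ)` (`a` prime to `7|D|`) is realised by `υ·γ₀^{r_n(a)}` with
# `υ ∈ Υ` (torsion cyclotomic subgroup), `χ_cyc(υ) = ω(a)`, `υ ζ = ζ^a` on `μ_{|D|}`, and `η₁(υ) = χ_D(a)·ω(a)⁵`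

Cell bsd-cm, seat bsd-cm-k-ty1 g27 (literature-prover); SUMMON `wake/SUMMON-bsd-cm-k-ty1-20260830T2140Z.md` (planner g36,
D972) block (A6-3) = File E (memo `pub/bsd-cm/bsd-cm-k-ty1/g26/G45-typing-memo.md` S9), FIRST brick.  File E pushes the exact
level identities of (A6-2) (`exists_twistedGenusUnit_eq_one`, p792529) into Tsuji's pinned `Λ`-module `𝓤` and reads them on the
`η₁`-line; the only handles on the Galois structure of `𝓤` are the pins (A) `rep_act` (the action of `Υ`) and (T) `rep_X_smul`
(the action of `γ₀`, `T = γ₀ − 1`), so every Galois translate `σ_a|_{F′ₙ}` occurring in the twisted Sinnott unit must be LIFTED to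
an element of `Υ·γ₀^ℕ` — the `TowerAction` file deliberately did not claim that `Υ` surjects onto the torsion of `Gal(F′ₙ/ℚ)`.
This file supplies the lifts from the tree's cyclotomic-character toolkit (`CyclotomicCharacterSurjectiveProofs.lean`:
surjectivity of `χ₇`, splitting of an automorphism into its `μ_{7^∞}`-part, prescribing the action on `μ_d`, gluing over coprime
moduli):

* §1 `smul_eq_pow_of_coprime` (CRT gluing for «acts as the `a`-th power»), `forall_smul_eq_of_le_sup_adjoin` (two automorphisms
  agreeing on generators agree on `E ⊔ ℚ(T)` for `E ≤ ℚ(S)`), `cyclotomicCharacter_eq_of_forall_smul_eq` (`χ₇` only sees `μ_{7^∞}`).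
* §2 ★ `GenusFrame.exists_torsionLift` — for `a` prime to `7|D|`: `υ ∈ Υ` with `χ₇(υ) = ω(a)` (Teichmüller) and `υ ζ = ζ^a` for
  every `|D|`-th root of unity `ζ`.
* §3 ★★ `GenusFrame.exists_towerLift` — the same `υ` satisfies, for EVERY level `n`: `(υ·γ₀^{r n a}) ζ = ζ^a` on `μ_{7^{n+1}}`
  (`χ₇(γ₀) = u`, the log table `u^{r n a}ω(a) ≡ a (7^{n+1})`), `(υ·γ₀^{r n a}) x = σ x` for every `x ∈ F′ₙ` and every `σ` with
  `σ(ζsys n) = (ζsys n)^a` (agreement on `F₀ ≤ ℚ(μ_{|D|})` and on `μ_{7^{n+1}}`, `F′ₙ = F₀ ⊔ ℚ(μ_{7^{n+1}})`), and the READING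
  `η₁(υ) = χ_D(a)·ω(a)⁵` (`η₁_reading` at `ζsys 0 ∈ μ_{7|D|}`).

HONEST LABEL: Galois bookkeeping on the frame's pins; no definition, no named fact, no instance; nothing closes;
stmt-BirchSwinnertonDyer-19945 OPEN; K1ᵘ NOT proved (Files E2–E4: kernel facts and pushes, the `Λ`-side reading of the exponent
sum against `x_spec`/`Θm_spec`/`W(b)`, the assembly ★★★/★★★★); `X12.CMRamifiedSeven` NOT proved; no summit statement is proved by
this seat; BSD is claimed for no curve.

## References
* T. Tsuji, J. Number Theory 78 (1999) §3 (pp. 5–6, «Gal(K_n/ℚ) ≅ G × Gal(K_n/K)»), §4 (p. 12, «χ = φω^i») [Tsuji1999].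
* L. C. Washington, *Introduction to Cyclotomic Fields* (1997) Thm. 2.5, Ch. 14 (p. 321, `Gal(ℚ(μ_∞)/ℚ) ≅ ∏ ℤ_pˣ`) [Washington1997].
* S. Lang, *Cyclotomic Fields I–II* (1990) Ch. 10 §1 (PDF p. 167, the log table) [Lang1990].
* Tree: `GaloisRepresentations/CyclotomicCharacterSurjectiveProofs.lean`, `GaloisRepresentations/GaloisRep.lean`
  (`cyclotomicCharacter_spec`, `cyclotomicCharacter_eq_one_of_forall_pow_eq_one`), `IwasawaTheory/CyclotomicColemanMap.lean`
  (`torsionCyclotomicSubgroup`, `fixingSubgroupQ`, `IsDirichletReading`, `IsTeichmullerCharacter`), `IwasawaTheory/StickelbergerSeries.lean`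
  (`IsLogTable`), `RamifiedSevenGenusFactorisationShape.lean` (the frame), `RamifiedSevenGenusSinnottSpan.lean` (`isPrimitiveRoot_ζsys_zero`).
-/

noncomputable section

open scoped NumberField
open Field Polynomial
open Literature.NumberTheory.IwasawaTheory
open Literature.NumberTheory.GaloisRepresentations

namespace Summit.BirchSwinnertonDyer.Rank1Residual.Additive.GenusSeven

/-! ## §1 Generalities: gluing, agreement on composita, `χ₇` sees only `μ_{7^∞}` -/

section General

/-- **CRT gluing for «acts as the `a`-th power»**: if `σ ζ = ζ^a` on the `A`-th and on the `B`-th roots of unity of `ℚ̄`,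
`A, B ≥ 1` coprime, then `σ ζ = ζ^a` on the `AB`-th roots of unity (`ζ = ζ^f·ζ^e`, `f ≡ 1 (A), 0 (B)`, `e ≡ 0 (A), 1 (B)`).
[cite: Washington1997, Thm. 2.5] -/
theorem smul_eq_pow_of_coprime {A B : ℕ} [NeZero A] [NeZero B] (hAB : A.Coprime B) (σ : absoluteGaloisGroup ℚ) (a : ℕ)
    (hA : ∀ ζ : AlgebraicClosure ℚ, ζ ^ A = 1 → σ • ζ = ζ ^ a)
    (hB : ∀ ζ : AlgebraicClosure ℚ, ζ ^ B = 1 → σ • ζ = ζ ^ a)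
    (ζ : AlgebraicClosure ℚ) (hζ : ζ ^ (A * B) = 1) : σ • ζ = ζ ^ a := by
  obtain ⟨e, heA, heB⟩ := Nat.chineseRemainder hAB 0 1
  obtain ⟨f, hfA, hfB⟩ := Nat.chineseRemainder hAB 1 0
  have hf : (ζ ^ (f : ℕ)) ^ A = 1 := by
    obtain ⟨c, hc⟩ := (Nat.modEq_zero_iff_dvd.mp hfB)
    rw [← pow_mul, hc, show B * c * A = A * B * c by ring, pow_mul, hζ, one_pow]
  have he : (ζ ^ (e : ℕ)) ^ B = 1 := by
    obtain ⟨c, hc⟩ := (Nat.modEq_zero_iff_dvd.mp heA)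
    rw [← pow_mul, hc, show A * c * B = A * B * c by ring, pow_mul, hζ, one_pow]
  have hsum : (f : ℕ) + e ≡ 1 [MOD A * B] :=
    (Nat.modEq_and_modEq_iff_modEq_mul hAB).mp ⟨by simpa using hfA.add heA, by simpa using hfB.add heB⟩
  have hζeq : ζ ^ (f : ℕ) * ζ ^ (e : ℕ) = ζ := by
    rw [← pow_add, pow_eq_pow_mod _ hζ, hsum, ← pow_eq_pow_mod _ hζ, pow_one]
  rw [← hζeq, smul_mul', hA _ hf, hB _ he, ← mul_pow]

/-- **Two automorphisms of `ℚ̄` agreeing on `S` and on `T` agree on `E ⊔ ℚ(T)` for every `E ≤ ℚ(S)`** (the set where they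
agree is an intermediate field).  The road: `E = F₀ ≤ ℚ(μ_{|D|})`, `T = μ_{7^{n+1}}`, `E ⊔ ℚ(T) = F′ₙ`. [cite: Tsuji1999, §3 (p. 5, «K_n = F(μ_{p^{n+1}})»)] -/
theorem forall_smul_eq_of_le_sup_adjoin {σ τ : absoluteGaloisGroup ℚ} {E : IntermediateField ℚ (AlgebraicClosure ℚ)}
    {S T : Set (AlgebraicClosure ℚ)} (hE : E ≤ IntermediateField.adjoin ℚ S)
    (hS : ∀ x ∈ S, σ • x = τ • x) (hT : ∀ x ∈ T, σ • x = τ • x) :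
    ∀ x : AlgebraicClosure ℚ, x ∈ E ⊔ IntermediateField.adjoin ℚ T → σ • x = τ • x := by
  -- the equaliser of `σ` and `τ` as an intermediate field
  let A : Subalgebra ℚ (AlgebraicClosure ℚ) :=
    AlgHom.equalizer (absoluteGaloisGroup.toAlgEquiv ℚ σ : AlgebraicClosure ℚ ≃ₐ[ℚ] AlgebraicClosure ℚ).toAlgHom
      (absoluteGaloisGroup.toAlgEquiv ℚ τ : AlgebraicClosure ℚ ≃ₐ[ℚ] AlgebraicClosure ℚ).toAlgHom
  have hmem : ∀ x : AlgebraicClosure ℚ, x ∈ A ↔ σ • x = τ • x := fun x => by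
    rw [AlgHom.mem_equalizer, absoluteGaloisGroup.smul_def, absoluteGaloisGroup.smul_def]
    rfl
  let L : IntermediateField ℚ (AlgebraicClosure ℚ) := A.toIntermediateField fun x hx => by
    rw [hmem] at hx ⊢
    rw [smul_inv'', hx, smul_inv'']
  have hmemL : ∀ x : AlgebraicClosure ℚ, x ∈ L ↔ σ • x = τ • x := fun x => by
    rw [← hmem]; rfl
  have hSL : IntermediateField.adjoin ℚ S ≤ L := IntermediateField.adjoin_le_iff.mpr fun x hx => (hmemL x).mpr (hS x hx)
  have hTL : IntermediateField.adjoin ℚ T ≤ L := IntermediateField.adjoin_le_iff.mpr fun x hx => (hmemL x).mpr (hT x hx)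
  intro x hx
  exact (hmemL x).mp (sup_le (hE.trans hSL) hTL hx)

/-- **`χ₇` sees only `μ_{7^∞}`**: two automorphisms with the same action on all `7`-power roots of unity have the same
`7`-adic cyclotomic character. [cite: Washington1997, Ch. 14 (p. 321)] -/
theorem cyclotomicCharacter_eq_of_forall_smul_eq {σ τ : absoluteGaloisGroup ℚ}
    (h : ∀ (k : ℕ) (ζ : AlgebraicClosure ℚ), ζ ^ 7 ^ k = 1 → σ • ζ = τ • ζ) :
    haveI : Fact (Nat.Prime 7) := ⟨Nat.prime_seven⟩
    GaloisRep.cyclotomicCharacter ℚ 7 σ = GaloisRep.cyclotomicCharacter ℚ 7 τ := by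
  haveI : Fact (Nat.Prime 7) := ⟨Nat.prime_seven⟩
  rw [← inv_mul_eq_one, ← map_inv, ← map_mul, GaloisRep.cyclotomicCharacter_apply]
  refine cyclotomicCharacter_eq_one_of_forall_pow_eq_one 7 _ fun k t ht => ?_
  show (σ⁻¹ * τ) • t = t
  rw [mul_smul, ← h k t ht, inv_smul_smul]

/-- An automorphism fixing the `m`-th roots of unity, inverted, still fixes them (and powers go through).
[cite: Washington1997, Thm. 2.5] -/
theorem inv_smul_eq_pow_of_smul_eq {σ : absoluteGaloisGroup ℚ} {ζ : AlgebraicClosure ℚ} (h : σ • ζ = ζ) (a : ℕ) :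
    σ⁻¹ • ζ ^ a = ζ ^ a := by
  have h' : σ⁻¹ • ζ = ζ := by rw [inv_smul_eq_iff, h]
  rw [smul_pow', h']

end General

/-! ## §2 The torsion lift of `a`: `υ ∈ Υ` with `χ₇(υ) = ω(a)` and `υ ζ = ζ^a` on `μ_{|D|}` -/

namespace GenusFrame

variable (F : GenusFrame)

/-- Every cyclotomic polynomial is irreducible over `ℚ` (Mathlib), in the shape the toolkit asks for.
[cite: Washington1997, Thm. 2.5] -/
theorem cyclotomic_irreducible_rat : ∀ n : ℕ, 0 < n → Irreducible (cyclotomic n ℚ) :=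
  fun _ hn => cyclotomic.irreducible_rat hn

/-- `ω(a)⁶ = 1` in `ℤ₇ˣ` for `a` prime to `7` (`#(ℤ/7)ˣ = 6`). [cite: Lang1990, Ch. 10 §1 (PDF p. 167)] -/
theorem omega_toUnitHom_pow_six {a : ℕ} (ha : a.Coprime 7) :
    (MulChar.toUnitHom F.ω (ZMod.unitOfCoprime a ha)) ^ 6 = 1 := by
  rw [← map_pow, show (6 : ℕ) = Nat.totient 7 by decide, ZMod.pow_totient, map_one]

/-- ★ **THE TORSION LIFT**: for `a` prime to `7|D|` there is `υ ∈ Υ` (torsion cyclotomic subgroup at `7`) with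
`χ₇(υ) = ω(a)` (the Teichmüller unit) and `υ ζ = ζ^a` for every `|D|`-th root of unity `ζ ∈ ℚ̄` — surjectivity of `χ₇`
(Teichmüller value), splitting off the `μ_{7^∞}`-part, prescribing the `μ_{|D|}`-part inside `ker χ₇`.
[cite: Washington1997, Thm. 2.5 and Ch. 14 (p. 321)] [cite: Tsuji1999, §3 (p. 6, «Gal(K_n/ℚ) ≅ G × Gal(K_n/K)»)] -/
theorem exists_torsionLift {a : ℕ} (ha : a.Coprime (7 * F.d)) :
    ∃ υ : torsionCyclotomicSubgroup 7,
      haveI : Fact (Nat.Prime 7) := ⟨Nat.prime_seven⟩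
      GaloisRep.cyclotomicCharacter ℚ 7 (υ : absoluteGaloisGroup ℚ) =
          MulChar.toUnitHom F.ω (ZMod.unitOfCoprime a (Nat.Coprime.coprime_mul_right_right ha)) ∧
        ∀ ζ : AlgebraicClosure ℚ, ζ ^ F.d = 1 → (υ : absoluteGaloisGroup ℚ) • ζ = ζ ^ a := by
  haveI : Fact (Nat.Prime 7) := ⟨Nat.prime_seven⟩
  haveI : NeZero F.d := ⟨F.d_ne_zero⟩
  haveI : NeZero (7 : ℕ) := ⟨by norm_num⟩
  have ha7 : a.Coprime 7 := Nat.Coprime.coprime_mul_right_right ha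
  have had : a.Coprime F.d := Nat.Coprime.coprime_mul_left_right ha
  -- (1) the Teichmüller part: `χ₇(g₂) = ω(a)`, `g₂` trivial on all prime-to-`7` roots of unity
  obtain ⟨g₁, hg₁⟩ := GaloisRep.cyclotomicCharacter_surjective ℚ 7 cyclotomic_irreducible_rat
    (MulChar.toUnitHom F.ω (ZMod.unitOfCoprime a ha7))
  obtain ⟨g₂, hg₂, hg₂'⟩ := RootOfUnityAction.exists_smul_eq_smul_and_smul_eq_self (K := ℚ) cyclotomic_irreducible_rat
    Nat.prime_seven g₁
  have hχg₂ : GaloisRep.cyclotomicCharacter ℚ 7 g₂ = MulChar.toUnitHom F.ω (ZMod.unitOfCoprime a ha7) := by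
    rw [← hg₁]; exact cyclotomicCharacter_eq_of_forall_smul_eq hg₂
  -- (2) the `μ_d`-part inside `ker χ₇`: `κ = σ₄⁻¹σ₃` acts on `μ_d` by `a` and fixes `μ_{7^∞}`
  obtain ⟨σ₃, hσ₃, -⟩ := RootOfUnityAction.exists_smul_eq_pow_and_smul_eq_self (K := ℚ) (A := F.d) (B := 7) F.d_coprime_seven
    (cyclotomic_irreducible_rat _ (Nat.mul_pos F.d_pos (by norm_num))) (ZMod.unitOfCoprime a had)
  obtain ⟨σ₄, hσ₄, hσ₄'⟩ := RootOfUnityAction.exists_smul_eq_smul_and_smul_eq_self (K := ℚ) cyclotomic_irreducible_rat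
    Nat.prime_seven σ₃
  have hκ7 : ∀ (k : ℕ) (ζ : AlgebraicClosure ℚ), ζ ^ 7 ^ k = 1 → (σ₄⁻¹ * σ₃) • ζ = (1 : absoluteGaloisGroup ℚ) • ζ := by
    intro k ζ hζ
    rw [one_smul, mul_smul, inv_smul_eq_iff, hσ₄ k ζ hζ]
  have hχκ : GaloisRep.cyclotomicCharacter ℚ 7 (σ₄⁻¹ * σ₃) = 1 := by
    rw [cyclotomicCharacter_eq_of_forall_smul_eq hκ7, map_one]
  have hκd : ∀ ζ : AlgebraicClosure ℚ, ζ ^ F.d = 1 → (σ₄⁻¹ * σ₃) • ζ = ζ ^ a := by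
    intro ζ hζ
    rw [mul_smul, hσ₃ ζ hζ, ZMod.coe_unitOfCoprime, ZMod.val_natCast, ← pow_eq_pow_mod a hζ]
    exact inv_smul_eq_pow_of_smul_eq (hσ₄' F.d F.d_coprime_seven.symm ζ hζ) a
  -- (3) `υ = g₂ κ`
  have hmem : g₂ * (σ₄⁻¹ * σ₃) ∈ torsionCyclotomicSubgroup 7 := by
    rw [mem_torsionCyclotomicSubgroup_iff, map_mul, hχg₂, hχκ, mul_one, CommGroup.mem_torsion, isOfFinOrder_iff_pow_eq_one]
    exact ⟨6, by norm_num, F.omega_toUnitHom_pow_six ha7⟩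
  refine ⟨⟨g₂ * (σ₄⁻¹ * σ₃), hmem⟩, ?_, fun ζ hζ => ?_⟩
  · rw [Subgroup.coe_mk, map_mul, hχg₂, hχκ, mul_one]
  · rw [Subgroup.coe_mk, mul_smul, hκd ζ hζ, smul_pow', hg₂' F.d F.d_coprime_seven.symm ζ hζ]

/-! ## §3 The tower lift at every level, agreement on `F′ₙ`, and the `η₁`-reading -/

/-- **`χ₇(υ·γ₀^j)` read modulo `7^{n+1}`**: for `χ₇(υ) = ω(a)` and `j = r n a` (the frame's log table,
`u^{r n a}·ω(a) ≡ a (7^{n+1})`, `χ₇(γ₀) = u`), `υ·γ₀^{r n a}` acts on `μ_{7^{n+1}}` as the `a`-th power.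
[cite: Lang1990, Ch. 10 §1 (PDF p. 167)] [cite: Tsuji1999, §3 (p. 6, «T = γ − 1»)] -/
theorem smul_eq_pow_of_cyclotomicCharacter_eq_omega {a : ℕ} (ha7 : a.Coprime 7) {υ : absoluteGaloisGroup ℚ}
    (hυ : haveI : Fact (Nat.Prime 7) := ⟨Nat.prime_seven⟩
      GaloisRep.cyclotomicCharacter ℚ 7 υ = MulChar.toUnitHom F.ω (ZMod.unitOfCoprime a ha7))
    (n : ℕ) (ζ : AlgebraicClosure ℚ) (hζ : ζ ^ 7 ^ (n + 1) = 1) : (υ * F.γ₀ ^ F.r n a) • ζ = ζ ^ a := by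
  haveI : Fact (Nat.Prime 7) := ⟨Nat.prime_seven⟩
  rw [GaloisRep.cyclotomicCharacter_spec ℚ 7 (k := n + 1) _ ζ hζ, map_mul, map_pow, hυ, F.cyclotomicCharacter_γ₀, Units.val_mul,
    Units.val_pow_eq_pow_val, MulChar.coe_toUnitHom, ZMod.coe_unitOfCoprime]
  -- the log table: `ω(a)·u^{r n a} ≡ a (mod 7^{n+1})`
  have hlog := F.r_logTable n a ha7
  have hker : (PadicInt.toZModPow (n + 1)) (F.ω (a : ZMod 7) * (F.u : ℤ_[7]) ^ F.r n a) =
      (PadicInt.toZModPow (n + 1)) ((a : ℕ) : ℤ_[7]) := by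
    rw [← RingHom.sub_mem_ker_iff, PadicInt.ker_toZModPow, mul_comm]
    exact hlog
  rw [hker, map_natCast, ZMod.val_natCast, ← pow_eq_pow_mod a hζ]

/-- `γ₀` (hence every power of it) fixes the bottom layer `F′₀ = F₀(μ₇)` pointwise. [cite: Tsuji1999, §3 (p. 6, «γ a topological generator of Gal(K_∞/K)»)] -/
theorem γ₀_pow_smul_eq_self (j : ℕ) {x : AlgebraicClosure ℚ} (hx : x ∈ F.layer 0) : (F.γ₀ ^ j) • x = x := by
  have h1 : F.γ₀ • x = x := by
    rw [absoluteGaloisGroup.smul_def]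
    exact (mem_fixingSubgroupQ_iff _ _).mp F.γ₀_mem x hx
  induction j with
  | zero => rw [pow_zero, one_smul]
  | succ j ih => rw [pow_succ, mul_smul, h1, ih]

/-- An automorphism acting on a primitive `m`-th root of unity as the `a`-th power acts so on every `k`-th root of unity,
`k ∣ m`. [cite: Washington1997, Thm. 2.5] -/
theorem smul_eq_pow_of_smul_primitiveRoot {m : ℕ} [NeZero m] {ζ₀ : AlgebraicClosure ℚ} (hζ₀ : IsPrimitiveRoot ζ₀ m)
    {σ : absoluteGaloisGroup ℚ}
    {a : ℕ} (hσ : σ • ζ₀ = ζ₀ ^ a) {k : ℕ} (hk : k ∣ m) (ζ : AlgebraicClosure ℚ) (hζ : ζ ^ k = 1) : σ • ζ = ζ ^ a := by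
  have hζm : ζ ^ m = 1 := by
    obtain ⟨c, rfl⟩ := hk
    rw [pow_mul, hζ, one_pow]
  obtain ⟨i, -, rfl⟩ := hζ₀.eq_pow_of_pow_eq_one hζm
  rw [smul_pow', hσ, ← pow_mul, ← pow_mul, mul_comm]

/-- ★★ **THE TOWER LIFT**: for `a` prime to `7|D|` there is `υ ∈ Υ` such that (i) `η₁(υ) = χ_D(a)·ω(a)⁵` (the frame's
Dirichlet reading of `η₁` at `ζsys 0`), (ii) `υ ζ = ζ^a` on `μ_{|D|}`, and for EVERY level `n`: (iii) `(υ·γ₀^{r n a}) ζ = ζ^a` on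
`μ_{7^{n+1}}`, (iv) `υ·γ₀^{r n a}` agrees on `F′ₙ` with every automorphism `σ` of `ℚ̄` acting on `ζsys n` as the `a`-th power
(e.g. C2b-γ's transport `σ n a`).  This is the lift through which File E reads the Galois translates of the twisted Sinnott unit
on Tsuji's `𝓤` (pins (A) and (T)). [cite: Tsuji1999, §3 (pp. 5–6) and §4 (p. 12, «χ = φω^i»)] [cite: Washington1997, Ch. 14 (p. 321)]
[cite: Lang1990, Ch. 10 §1 (PDF p. 167)] -/
theorem exists_towerLift {a : ℕ} (ha : a.Coprime (7 * F.d)) :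
    ∃ υ : torsionCyclotomicSubgroup 7,
      ((F.η₁ υ : ℤ_[7]ˣ) : ℤ_[7]) = F.χD (a : ZMod F.d) * F.ω (a : ZMod 7) ^ 5 ∧
      (∀ ζ : AlgebraicClosure ℚ, ζ ^ F.d = 1 → (υ : absoluteGaloisGroup ℚ) • ζ = ζ ^ a) ∧
      ∀ n : ℕ,
        (∀ ζ : AlgebraicClosure ℚ, ζ ^ 7 ^ (n + 1) = 1 → ((υ : absoluteGaloisGroup ℚ) * F.γ₀ ^ F.r n a) • ζ = ζ ^ a) ∧
        ∀ σ : absoluteGaloisGroup ℚ, σ • F.ζsys n = F.ζsys n ^ a →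
          ∀ x : AlgebraicClosure ℚ, x ∈ F.layer n → ((υ : absoluteGaloisGroup ℚ) * F.γ₀ ^ F.r n a) • x = σ • x := by
  haveI : Fact (Nat.Prime 7) := ⟨Nat.prime_seven⟩
  haveI : NeZero F.d := ⟨F.d_ne_zero⟩
  haveI : NeZero (7 : ℕ) := ⟨by norm_num⟩
  have ha7 : a.Coprime 7 := Nat.Coprime.coprime_mul_right_right ha
  obtain ⟨υ, hχ, hd⟩ := F.exists_torsionLift ha
  have h7 : ∀ (n : ℕ) (ζ : AlgebraicClosure ℚ), ζ ^ 7 ^ (n + 1) = 1 →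
      ((υ : absoluteGaloisGroup ℚ) * F.γ₀ ^ F.r n a) • ζ = ζ ^ a :=
    fun n ζ hζ => F.smul_eq_pow_of_cyclotomicCharacter_eq_omega ha7 hχ n ζ hζ
  -- `υ` alone acts on `μ₇` as the `a`-th power (`γ₀` fixes `μ₇ ⊂ F′₀`)
  have h7' : ∀ ζ : AlgebraicClosure ℚ, ζ ^ 7 = 1 → (υ : absoluteGaloisGroup ℚ) • ζ = ζ ^ a := by
    intro ζ hζ
    have hζ' : ζ ^ 7 ^ (0 + 1) = 1 := by rwa [zero_add, pow_one]
    have h := h7 0 ζ hζ'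
    rwa [mul_smul, F.γ₀_pow_smul_eq_self _ (mem_cyclotomicLayer_of_pow_eq_one F.F₀ 7 0 hζ')] at h
  refine ⟨υ, ?_, hd, fun n => ⟨h7 n, fun σ hσ x hx => ?_⟩⟩
  · -- the `η₁`-reading at `ζsys 0 ∈ μ_{7|D|}`: `υ (ζsys 0) = (ζsys 0)^a` by gluing `μ_{|D|}` and `μ₇`
    have hζ0 : (υ : absoluteGaloisGroup ℚ) • F.ζsys 0 = F.ζsys 0 ^ a :=
      smul_eq_pow_of_coprime F.d_coprime_seven _ a hd h7' _ F.isPrimitiveRoot_ζsys_zero.pow_eq_one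
    have h := F.η₁_reading υ a (by rw [← absoluteGaloisGroup.smul_def]; exact hζ0)
    rw [h]
  · -- agreement on `F′ₙ = F₀ ⊔ ℚ(μ_{7^{n+1}})`: on `μ_{|D|} ⊇` generators of `F₀`, and on `μ_{7^{n+1}}`
    haveI : NeZero (7 ^ (n + 1) * F.d) := ⟨(Nat.mul_pos (pow_pos (by norm_num) _) F.d_pos).ne'⟩
    have hσd : ∀ ζ : AlgebraicClosure ℚ, ζ ^ F.d = 1 → σ • ζ = ζ ^ a :=
      smul_eq_pow_of_smul_primitiveRoot (F.ζsys_compatible.1 n) hσ (Dvd.intro_left _ rfl)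
    have hσ7 : ∀ ζ : AlgebraicClosure ℚ, ζ ^ 7 ^ (n + 1) = 1 → σ • ζ = ζ ^ a :=
      smul_eq_pow_of_smul_primitiveRoot (F.ζsys_compatible.1 n) hσ (Dvd.intro _ rfl)
    -- `υ` and `σ` agree on `ℚ(μ_{|D|}) ⊇ F₀`; `γ₀` fixes `F₀`
    have hυσ : ∀ x : AlgebraicClosure ℚ, x ∈ (⊥ : IntermediateField ℚ (AlgebraicClosure ℚ)) ⊔
        IntermediateField.adjoin ℚ {x : AlgebraicClosure ℚ | x ^ F.D.natAbs = 1} → (υ : absoluteGaloisGroup ℚ) • x = σ • x :=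
      forall_smul_eq_of_le_sup_adjoin (S := (∅ : Set (AlgebraicClosure ℚ))) (by simp) (fun x hx => absurd hx (Set.notMem_empty x))
        fun x hx => by rw [hd x hx, hσd x hx]
    have hS : ∀ x ∈ (F.F₀ : Set (AlgebraicClosure ℚ)), ((υ : absoluteGaloisGroup ℚ) * F.γ₀ ^ F.r n a) • x = σ • x := by
      intro x hx
      have hx0 : x ∈ F.layer 0 := le_cyclotomicLayer F.F₀ 7 0 hx
      rw [mul_smul, F.γ₀_pow_smul_eq_self _ hx0]
      exact hυσ x ((le_sup_right : IntermediateField.adjoin ℚ {x : AlgebraicClosure ℚ | x ^ F.D.natAbs = 1} ≤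
        ⊥ ⊔ IntermediateField.adjoin ℚ {x : AlgebraicClosure ℚ | x ^ F.D.natAbs = 1}) (F.F₀_le hx))
    have hT : ∀ x ∈ {x : AlgebraicClosure ℚ | x ^ 7 ^ (n + 1) = 1},
        ((υ : absoluteGaloisGroup ℚ) * F.γ₀ ^ F.r n a) • x = σ • x := fun x hx => by rw [h7 n x hx, hσ7 x hx]
    exact forall_smul_eq_of_le_sup_adjoin (IntermediateField.subset_adjoin ℚ (F.F₀ : Set (AlgebraicClosure ℚ))) hS hT x
      (by rw [← cyclotomicLayer_def]; exact hx)

end GenusFrame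

end Summit.BirchSwinnertonDyer.Rank1Residual.Additive.GenusSeven

end
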